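/-
COR-CM (cells pub-hodgecm / pub-hodgecm2, stage 2 of the Hodge ladder) — TRANSPOSITION SURGE, item (vi) sub-binder S2 / (vi-2)
`supply`, PINNING RECORD, part 1 of 3 (REACH HALF `hReach`), THIRD FILE: the component pin at the Appendix-C datum ALONG AN ARBITRARY
COMPLEX EMBEDDING `e ι₁ : F →+* ℂ` of the pin (package-agnostic form of `Transposition/Item6PinReachGlue.lean`: `e ι₁ = ι₁` is that
file; `e ι₁ = ῑ₁ := conj ∘ ι₁` is the conj-free Shimura-side package of s2crux-idea-1's L-GEO brief 2026-08-21, HOME/INBOX l.4747 /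
ROUTES.md §8.9).  Seat prover-pub-hodgecm2-pin-1-g2-0 (pin-1 gen 2, owner of record of binder `hComp`, coordinator ruling
2026-08-21T18:44:30Z; path under the pub-hodgecm2 lead's blanket pre-ACK `Transposition/Item6*`).  THEOREMS ONLY: no definition, no
instance, no named fact, no `variable`, nothing asserted, no proof holes; `h₁`/`h₃` are explicit binders needed only to STATE the tree
surface; every `∀ F`-binder is face-guarded `IsGalois ℚ F → 6 ≤ [F:ℚ] → ι₁ ∈ Φ`.  Nothing in the tree is edited or restated.
FRAMING: HC_CM is NOT proved.
-/
import Summits.HodgeConjecture.CorCM.B01.Transposition.Item6PinReach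
import Literature.NumberTheory.Automorphic.Liu2021.AppendixC.Glue
import Literature.AlgebraicGeometry.Motives.FiberBaseChange
import Literature.AlgebraicGeometry.Motives.VarietiesProperProofs
import Summits.HodgeConjecture.CorCM.AlbaneseSideModelMatch
import Summits.HodgeConjecture.CorCM.B01.HeckePair
import HarnessLib

/-!
# Item (vi) S2, the pinned junction at the Appendix-C datum ALONG `e ι₁`: `hReach` from {`hUnif`, `hAlb`} for either package

The consumer of own-htheta's pinned junction chooses the complex pin `Aμ F ι₁ V Φ D_μ : AbelianVariety ℂ`.  With Liu's `A_μ` «an abelian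
variety over `E`» (Def. 4.5 (2) l. 1944, Glue `Thm418Rest.Aμ`) the pin is a base change `A_μ ⊗_{E,e ι₁} ℂ` along SOME complex embedding
`e ι₁` of `E = F` attached to the face's `ι₁`.  Two packages are on the table for the hComp / hCMisogE teams (s2crux-idea-1, L-GEO brief):
* `e ι₁ = ι₁` (package P1 = `Item6PinReachGlue.lean`): the pieces of `X_K ⊗_{E,ι₁} ℂ` are CONJUGATES of tree surfaces, `≅ P_{Γ'}(V)@ι₁` only
  after a level transport `Γ' = A·c(Γ)·A⁻¹` (V-cplx: Deligne's domain for Liu's `h_{V,ι₁}` is the conjugate of the tree's tautological ball at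
  `ι₁`, [Liu2021 App. C l. 4583–4596; Milne ISV (21), Thm. 2.14]); the CM side reads `A_μ ⊗_{E,ι₁} ℂ`.
* `e ι₁ = ῑ₁ := conj ∘ ι₁` (package P2′): Prop. C.5 is printed «for EVERY `τ' ∈ Φ_E` above `τ`» (l. 4628), and at `τ' = ῑ₁` Deligne's domain
  IS the tree's tautological ball at `ι₁`, so the pieces of `X_K ⊗_{E,ῑ₁} ℂ` are the tree's `P_{Γ_g}(V)@ι₁` with NATURAL levels
  `Γ_g = U(V)(F⁺) ∩ gKg⁻¹` (mc-binder-2 `Deligne1979.exists_components_homeomorph_ballQuotient`, p298845); Liu's carriers `A_K`, `A_μ` over `E`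
  and `Hom_E(A_K, A_μ)_ℚ = HomK` (rfl) are untouched; the CM side then reads `A_μ ⊗_{E,ῑ₁} ℂ = conj(A_μ ⊗_{E,ι₁} ℂ)` (lemma (CR) of the
  hCMisogE team: an `𝓞_{M_μ}`-realisation of `Ψ` with action precomposed by `c_{M_μ}` realises `Ψ` on the conjugate).
This file proves pin-1's side ONCE for every `e`, so the package decision of the team leads changes only the instance:

* §1 `Model.pinReach_of_componentPinC_along (e)` — own-htheta's `hReach` VERBATIM at `D := toThm418Data (C …) (R …)` and the pin
  `(letI := (e F ι₁).toAlgebra; ((R …).Aμ D_μ).baseChange ℂ)`, from the one binder `hComp` read on `Alb_{X_K} ⊗_{E,e ι₁} ℂ` (tree §1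
  `pinReach_of_componentPin` generic pin; the Hom tie is `rfl` and (U1) is binder-1's faithfulness p288061 along `e ι₁`).
* §2 `Model.hComp_of_unif_of_alb_along (e)` — that `hComp` DERIVED from `hUnif` (Deligne 2.1.2 on Liu's carrier `Sh(G(τ), h_{V(τ),e ι₁})`,
  pieces ball-uniformised by the tree's tautological ball at `ι₁`, levels EXISTENTIAL) and `hAlb` (Liu §2.1: `Alb` vs base change along
  `e ι₁` and components), the kernel consuming Prop. C.5's iso at `τ' = e ι₁`, «projective if `d > 1`» + `S̃h = Sh`, base-change transitivity.
* §3 `Model.pinReach_of_componentPinC_of_unif_of_alb_along (e)` — the composite (P2′ is its instance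
  `e := fun _ ι₁ => (starRingEnd ℂ).comp ι₁`, P1 the instance `e := fun _ ι₁ => ι₁`).
* §5 `Model.hUnif_of_treeCofan_along` — the CONSUMER-SIDE SIMPLIFICATION for TEAM hComp: `hUnif` follows from `hTree` = «Liu's
  `Sh(G(τ), h_{V(τ),e ι₁})_K ⊗ ℂ` is a finite coproduct of TREE surfaces `P_{Γ_c}(V)`» (the pieces then carry the tree's own ball data,
  `Model.ballDatum_Hℂ` / `Model.ballDatum_pmsCode_map_Γ`), so no per-component ball datum has to be built by the team; and
  `Model.pinReach_of_treeCofan_of_alb_along` — `hReach` from {`hTree`, `hAlb`} end to end.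

STRENGTH / T5: as `Item6PinReachGlue.lean` (§1: one binder `hComp`; §2–§4: the pair {hUnif, hAlb}; inhabited by degenerate token data, so no
contradiction from the pin binders alone; class O; no «↔ B01-S»).  No printed HYPOTHESIS of [Liu2021] Thm. 4.18 / App. C fails at a general
Galois CM field of degree `≥ 6` or a general face.  HC_CM is NOT proved.

References: Y. Liu, arXiv:2102.11518 = Camb. J. Math. 9 (2021) (`FJcycle.tex` md5 6db49a74122d): §2.1 Prop. l. 1185–1200, Def. 2.3, Lemma 2.2;
§4.2 l. 2053–2076; Def. 4.5 (2) l. 1944; Thm. 4.18 (1) l. 2239; App. C l. 4583–4599, Rem. C.2 l. 4602–4609, l. 4624, Prop. C.5 l. 4627–4637,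
l. 4656.  P. Deligne, *Variétés de Shimura* (Corvallis 1979) §2.1.2.  J. Milne, *Introduction to Shimura Varieties* (21), Thm. 2.14, 5.13, 5.17.
U. Görtz, T. Wedhorn, *Algebraic Geometry I* (2020) Prop. 4.16, Thm. 14.72 (1).
-/

noncomputable section

open scoped TensorProduct

namespace Summit.HodgeConjecture.CorCM.Model

open CategoryTheory CategoryTheory.Limits AlgebraicGeometry NumberField
open Literature.AlgebraicGeometry.Motives
open Literature.AlgebraicGeometry.HodgeTheory
open Literature.AlgebraicGeometry.ShimuraVarieties
open Literature.NumberTheory.Automorphic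
open Literature.NumberTheory.Automorphic.PicardCM
open Literature.NumberTheory.Automorphic.Liu2021
open Literature.NumberTheory.Automorphic.Liu2021.AppendixC

/-! ## §1  `hReach` at the Appendix-C datum, pin `A_μ ⊗_{E,e ι₁} ℂ`, from `hComp` read along `e ι₁` -/

section GlueDatumAlong

/-- **`hReach` at the APPENDIX-C DATUM along `e ι₁`** (`U = picardCMUniverse hHD hI h₁ h₃`; conclusion = own-htheta's binder `hReach` of
`Model.faceSupply_of_thm418AsPrinted_pinned` at `D F ι₁ V Φ := toThm418Data (C F ι₁ V Φ) (R F ι₁ V Φ)` and the pin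
`Aμ … D_μ := (letI := (e F ι₁).toAlgebra; ((R …).Aμ D_μ).baseChange ℂ) = A_μ ⊗_{E,e ι₁} ℂ`).  Carriers as in `pinReach_of_componentPinC`
(`P5` = Prop. C.5 datum, `iso` = «`𝕍 ⊗ ℚ_p` isotropic», `C` = §4.2 data with `A_K := Alb_{X_K}`, `R` = the rest of Thm. 4.18's data with
`A_μ` over `E`); `e : ∀ F, (F →+* ℂ) → (F →+* ℂ)` = the consumer's embedding for the pin (`fun _ ι₁ => ι₁`: package P1;
`fun _ ι₁ => (starRingEnd ℂ).comp ι₁`: package P2′).  ONE binder: `hComp` = (U3ᶜ) read on `Alb_{X_K} ⊗_{E,e ι₁} ℂ` — below some open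
compact `Ksm`, for open compact `K ≤ Ksm`, a product (limit fan) of Albanese data of finitely many `ℂ`-surfaces each ball-uniformised by the
tree's tautological ball of `V^{ι₁}` with group `ι₁(Γ_c)`, `Γ_c` SOME `Level V` (READING binder; split at its printed seams in §2).  KERNEL:
tree `pinReach_of_componentPin` (generic complex pin) with `hcar` DISCHARGED: `HomK K D_μ = ℚ ⊗_ℤ Hom_E(A_{levelOf K}, A_μ D_μ)` by `rfl`
(`toThm418Data_HomK`), a non-zero element has a non-zero `f : A_K ⟶ A_μ` behind it (`exists_ne_zero_of_tmul_ne_zero`) and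
`f ⊗_{E,e ι₁} ℂ ≠ 0` (binder-1 p288061 `AbelianVariety.Hom.baseChange_ne_zero`, Görtz–Wedhorn 14.72 (1)).  HC_CM is NOT proved; `hComp` is not
inhabited here.  CITATION SCOPE of the tag: the carrier sentences (Thm. 4.18 (1) l. 2239; §4.2 l. 2066; Def. 4.5 (2) l. 1944) and
Görtz–Wedhorn; the derivation is ours.
[cite: Liu2021, Thm. 4.18 (1) (FJcycle.tex l. 2239), §4.2 l. 2066 and Def. 4.5 (2) l. 1944 (carriers `Hom_E(A_K, A_μ)_ℚ`, `A_K`, `A_μ`)]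
[cite: GortzWedhorn2020, Theorem 14.72 (1)] -/
theorem pinReach_of_componentPinC_along
    (h₁ : BallQuotientUniformised) (h₃ : CMAbelianVarietyRealised)
    (e : ∀ (F : CMField), (F →+* ℂ) → (F →+* ℂ))
    (P5 : ∀ (F : CMField) (ι₁ : F →+* ℂ) (_ : HermSpace3 F ι₁) (_ : CMType F), PropC5Data (maximalRealSubfield F) F)
    (iso : ∀ (F : CMField) (ι₁ : F →+* ℂ) (_ : HermSpace3 F ι₁) (_ : CMType F), ℕ → Prop)
    (C : ∀ (F : CMField) (ι₁ : F →+* ℂ) (V : HermSpace3 F ι₁) (Φ : CMType F), Sec42Data (P5 F ι₁ V Φ) (iso F ι₁ V Φ))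
    (R : ∀ (F : CMField) (ι₁ : F →+* ℂ) (V : HermSpace3 F ι₁) (Φ : CMType F), Thm418Rest (C F ι₁ V Φ))
    (hComp : ∀ (F : CMField), IsGalois ℚ F → 6 ≤ Module.finrank ℚ F → ∀ (Φ : CMType F) (ι₁ : F →+* ℂ), ι₁ ∈ Φ.1 →
      ∀ V : HermSpace3 F ι₁, ∃ Ksm : Subgroup (toThm418Data (C F ι₁ V Φ) (R F ι₁ V Φ)).G, IsOpenCompact Ksm ∧
        ∀ K : Subgroup (toThm418Data (C F ι₁ V Φ) (R F ι₁ V Φ)).G, IsOpenCompact K → K ≤ Ksm →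
          ∃ (Cset : Type) (_ : Fintype Cset) (X : Cset → SchemeOver ℂ) (B : ∀ c, UnitaryBallUniformisationDatum 2 (X c))
            (Γ : Cset → Level V) (𝒥 : ∀ c, Jacobian (X c))
            (π : ∀ c, (letI := (e F ι₁).toAlgebra; ((C F ι₁ V Φ).A ((C F ι₁ V Φ).levelOf K)).baseChange ℂ) ⟶ (𝒥 c).J),
            (∀ c, (B c).Hℂ = V.Hm.map ι₁) ∧
            (∀ c, (B c).Γ.map (Matrix.GeneralLinearGroup.map (B c).τ₁) =
              (Γ c).Γ.map (Matrix.GeneralLinearGroup.map ι₁)) ∧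
            Nonempty (IsLimit (Fan.mk (letI := (e F ι₁).toAlgebra; ((C F ι₁ V Φ).A ((C F ι₁ V Φ).levelOf K)).baseChange ℂ) π))) :
    ∀ (F : CMField), IsGalois ℚ F → 6 ≤ Module.finrank ℚ F → ∀ (Φ : CMType F) (ι₁ : F →+* ℂ), ι₁ ∈ Φ.1 →
      ∀ V : HermSpace3 F ι₁, ∃ Ksm : Subgroup (toThm418Data (C F ι₁ V Φ) (R F ι₁ V Φ)).G, IsOpenCompact Ksm ∧
        ∀ (K : Subgroup (toThm418Data (C F ι₁ V Φ) (R F ι₁ V Φ)).G) (Dμ : (toThm418Data (C F ι₁ V Φ) (R F ι₁ V Φ)).Obj)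
          (φ : (toThm418Data (C F ι₁ V Φ) (R F ι₁ V Φ)).HomK K Dμ),
          IsOpenCompact K → K ≤ Ksm → φ ≠ 0 →
            ∃ (Γ : Level V) (𝒥 : Jacobian (Var.scheme (ballQuotientUniformisedDatum_of h₁) h₃ (.pms (pmsCode F ι₁ V Γ))))
              (w : 𝒥.J ⟶ (letI := (e F ι₁).toAlgebra; ((R F ι₁ V Φ).Aμ Dμ).baseChange ℂ)), w ≠ 0 := by
  refine pinReach_of_componentPin h₁ h₃ (fun F ι₁ V Φ => toThm418Data (C F ι₁ V Φ) (R F ι₁ V Φ))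
    (fun F ι₁ V Φ Dμ => letI := (e F ι₁).toAlgebra; ((R F ι₁ V Φ).Aμ Dμ).baseChange ℂ)
    (fun F ι₁ V Φ K => letI := (e F ι₁).toAlgebra; ((C F ι₁ V Φ).A ((C F ι₁ V Φ).levelOf K)).baseChange ℂ) ?_ hComp
  intro F _ _ Φ ι₁ _ V K Dμ φ _ hφ
  letI := (e F ι₁).toAlgebra
  -- a non-zero `E`-homomorphism `A_{levelOf K} ⟶ A_μ D_μ` behind `φ ∈ ℚ ⊗ Hom`, non-zero after base change along `e ι₁`
  obtain ⟨f, hf⟩ := exists_ne_zero_of_tmul_ne_zero hφ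
  exact ⟨AbelianVariety.Hom.baseChange ℂ f, AbelianVariety.Hom.baseChange_ne_zero ℂ hf⟩

end GlueDatumAlong

/-! ## §2  `hComp` along `e ι₁` split at the printed seams: Prop. C.5 at `τ' = e ι₁` + Compact Case used in the kernel -/

section SplitAlong

/-- **(U3ᶜ) `hComp` along `e ι₁` DERIVED from `hUnif` + `hAlb`** — the package-agnostic form of `hComp_of_unif_of_alb` (that theorem is the
instance `e ι₁ = ι₁`).  Binders, each with ONE source, demanded only for Galois CM `F` with `6 ≤ [F:ℚ]`, `Φ ∋ ι₁`, every `V`: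
* `hUnif` — for every `τ ∈ Φ_F` below `e ι₁` (`C5.IsAbove τ (e F ι₁)`), below some open compact `Ksm`, for every open compact `K ≤ Ksm` regarded
  in `G(τ)(𝔸^∞)` through the fixed isomorphism (Prop. C.5 l. 4632), LIU'S isometry-type Shimura variety `Sh(G(τ), h_{V(τ),e ι₁})_K` over
  `(e ι₁)(E)` (carrier `(P5 …).Sh τ (e F ι₁)`, Rem. C.2) base-changed to `ℂ` is a finite COPRODUCT (colimit cofan) of `ℂ`-surfaces `X c`, each with
  `B c : UnitaryBallUniformisationDatum 2 (X c)` of complex Gram matrix `V.Hm^{ι₁}` (the tree's TAUTOLOGICAL ball at `ι₁`) and group `ι₁(Γ_c)` for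
  SOME `Γ c : Level V` (EXISTENTIAL in `Γ`).  SOURCE (not Liu2021): [Deligne 1979 §2.1.2] `Sh_K(ℂ) = ⊔_g Γ_g\X⁺`, with the V-cplx reading
  [Milne ISV (21), Thm. 2.14; Liu App. C l. 4583–4596]: `X⁺ = conj 𝔹(V ⊗_{E,e ι₁} ℂ)_taut`; hence at `e ι₁ = ῑ₁` the pieces are the tree's
  `P_{Γ_g}(V)@ι₁` with NATURAL levels (conj-free: mc-binder-2 p298845), at `e ι₁ = ι₁` they are `≅ P_{Γ'_g}(V)@ι₁` with TRANSPORTED levels.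
  Residual (R1) = carrier instantiation (`P5.V τ`, `.Gτ τ`, `.fix τ`, `.Sh τ (e ι₁)` ARE the isometry-type data of the tree's `V`).
* `hAlb` — for every sufficiently small `K'` and every finite coproduct decomposition of `X_{K'} ⊗_{E,e ι₁} ℂ` into smooth projective
  geometrically irreducible surfaces, Albanese data `𝒥 c` with `Alb_{X_{K'}} ⊗_{E,e ι₁} ℂ = ∏_c Alb_{X_c}` (limit fan).  SOURCE: [Liu2021 §2.1,
  Prop. l. 1185–1200 (split field, Serre's pointed Albanese per component, Galois descent), Def. 2.3, Lemma 2.2 (1) along any `τ : k → ℂ`].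
KERNEL (ours): as `hComp_of_unif_of_alb` with `e ι₁` for `ι₁` on the Shimura side — `τ :=` the real embedding under `(e ι₁)|F⁺`
(`mem_maximalRealSubfield_iff`); `Ksm := Ksm_unif ⊓ K₀`; `levelOf K = K` (`Sec42Data.coe_levelOf`); `X_K ⊗ ℂ ≅ Sh(𝕍)_K ⊗ ℂ` by «projective if
`d > 1`» (`CompactifiedSystem.projective_Sh_of`, `d = [F⁺:ℚ] ≥ 3`) and `isIso_j_of_isProper`; `≅ (Sh(𝕍)_K ⊗_{E,e ι₁} (e ι₁)(E)) ⊗ ℂ`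
(`baseChangeHomObjIsoOfComp`) `≅ Sh(G(τ), h_{V(τ),e ι₁})_{fix τ K} ⊗ ℂ` (Prop. C.5 at `τ' = e ι₁`: `(C …).S.iso τ (e F ι₁)`); transport the cofan;
apply `hAlb`.  HC_CM is NOT proved; `hUnif`, `hAlb` are not inhabited here.  CITATION SCOPE of the tag: Prop. C.5, l. 4656, §4.2 l. 2066 /
Def. 2.3 — the clauses the kernel USES; `hUnif` is Deligne's, `hAlb` is Liu §2.1's, the derivation is ours.
[cite: Liu2021, Prop. C.5 (FJcycle.tex l. 4627–4637), App. C l. 4656, §4.2 l. 2060–2066, Def. 2.3 and the Proposition l. 1185–1200]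
[cite: Deligne1979ShimuraVarieties, §2.1.2] -/
theorem hComp_of_unif_of_alb_along
    (e : ∀ (F : CMField), (F →+* ℂ) → (F →+* ℂ))
    (P5 : ∀ (F : CMField) (ι₁ : F →+* ℂ) (_ : HermSpace3 F ι₁) (_ : CMType F), PropC5Data (maximalRealSubfield F) F)
    (iso : ∀ (F : CMField) (ι₁ : F →+* ℂ) (_ : HermSpace3 F ι₁) (_ : CMType F), ℕ → Prop)
    (C : ∀ (F : CMField) (ι₁ : F →+* ℂ) (V : HermSpace3 F ι₁) (Φ : CMType F), Sec42Data (P5 F ι₁ V Φ) (iso F ι₁ V Φ))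
    (hUnif : ∀ (F : CMField), IsGalois ℚ F → 6 ≤ Module.finrank ℚ F → ∀ (Φ : CMType F) (ι₁ : F →+* ℂ), ι₁ ∈ Φ.1 →
      ∀ (V : HermSpace3 F ι₁) (τ : maximalRealSubfield F →+* ℝ), C5.IsAbove τ (e F ι₁) →
        ∃ Ksm : Subgroup (P5 F ι₁ V Φ).G, IsOpenCompact Ksm ∧
          ∀ K : C5.OpenCompactSubgroup (P5 F ι₁ V Φ).G, K.1 ≤ Ksm →
            ∃ (Cset : Type) (_ : Fintype Cset) (X : Cset → SchemeOver ℂ) (B : ∀ c, UnitaryBallUniformisationDatum 2 (X c))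
              (Γ : Cset → Level V)
              (inj : ∀ c, X c ⟶ (baseChangeHom (e F ι₁).fieldRange.subtype).obj
                (((P5 F ι₁ V Φ).Sh τ (e F ι₁)).obj (C5.OpenCompactSubgroup.transport ((P5 F ι₁ V Φ).fix τ) K))),
              (∀ c, (B c).Hℂ = V.Hm.map ι₁) ∧
              (∀ c, (B c).Γ.map (Matrix.GeneralLinearGroup.map (B c).τ₁) =
                (Γ c).Γ.map (Matrix.GeneralLinearGroup.map ι₁)) ∧
              Nonempty (IsColimit (Cofan.mk _ inj)))
    (hAlb : ∀ (F : CMField), IsGalois ℚ F → 6 ≤ Module.finrank ℚ F → ∀ (Φ : CMType F) (ι₁ : F →+* ℂ), ι₁ ∈ Φ.1 →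
      ∀ (V : HermSpace3 F ι₁) (K' : C5.SmallLevel (C F ι₁ V Φ).S.K₀) (Cset : Type) (_ : Fintype Cset) (X : Cset → SchemeOver ℂ)
        (inj : ∀ c, X c ⟶ (baseChangeHom (e F ι₁)).obj ((C F ι₁ V Φ).X K')),
        (∀ c, IsSmoothProjective 2 (X c)) → Nonempty (IsColimit (Cofan.mk _ inj)) →
          ∃ (𝒥 : ∀ c, Jacobian (X c)) (π : ∀ c, (letI := (e F ι₁).toAlgebra; ((C F ι₁ V Φ).A K').baseChange ℂ) ⟶ (𝒥 c).J),
            Nonempty (IsLimit (Fan.mk (letI := (e F ι₁).toAlgebra; ((C F ι₁ V Φ).A K').baseChange ℂ) π))) :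
    ∀ (F : CMField), IsGalois ℚ F → 6 ≤ Module.finrank ℚ F → ∀ (Φ : CMType F) (ι₁ : F →+* ℂ), ι₁ ∈ Φ.1 →
      ∀ V : HermSpace3 F ι₁, ∃ Ksm : Subgroup (C F ι₁ V Φ).G, IsOpenCompact Ksm ∧
        ∀ K : Subgroup (C F ι₁ V Φ).G, IsOpenCompact K → K ≤ Ksm →
          ∃ (Cset : Type) (_ : Fintype Cset) (X : Cset → SchemeOver ℂ) (B : ∀ c, UnitaryBallUniformisationDatum 2 (X c))
            (Γ : Cset → Level V) (𝒥 : ∀ c, Jacobian (X c))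
            (π : ∀ c, (letI := (e F ι₁).toAlgebra; ((C F ι₁ V Φ).A ((C F ι₁ V Φ).levelOf K)).baseChange ℂ) ⟶ (𝒥 c).J),
            (∀ c, (B c).Hℂ = V.Hm.map ι₁) ∧
            (∀ c, (B c).Γ.map (Matrix.GeneralLinearGroup.map (B c).τ₁) =
              (Γ c).Γ.map (Matrix.GeneralLinearGroup.map ι₁)) ∧
            Nonempty (IsLimit (Fan.mk (letI := (e F ι₁).toAlgebra; ((C F ι₁ V Φ).A ((C F ι₁ V Φ).levelOf K)).baseChange ℂ) π)) := by
  intro F hG h6 Φ ι₁ hι V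
  -- the real embedding `τ` of `F⁺ = maximalRealSubfield F` under `e ι₁`
  have hreal : ComplexEmbedding.IsReal ((e F ι₁).comp (algebraMap (maximalRealSubfield F) F)) := by
    rw [ComplexEmbedding.isReal_iff]
    ext x
    rw [ComplexEmbedding.conjugate_coe_eq]
    exact (mem_maximalRealSubfield_iff (x : F)).1 x.2 (e F ι₁)
  set τ : maximalRealSubfield F →+* ℝ := hreal.embedding
  have hτ : C5.IsAbove τ (e F ι₁) := by
    ext x
    simp [τ, ComplexEmbedding.IsReal.coe_embedding_apply]
  -- thresholds: `hUnif`'s `Ksm` and the system's `K₀`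
  obtain ⟨KsmU, hKsmU, hunif⟩ := hUnif F hG h6 Φ ι₁ hι V τ hτ
  set K₀ := (C F ι₁ V Φ).S.K₀
  refine ⟨KsmU ⊓ K₀.1, ⟨?_, ?_⟩, fun K hK hle => ?_⟩
  · simpa only [Subgroup.coe_inf] using hKsmU.1.inter K₀.2.1
  · simpa only [Subgroup.coe_inf] using K₀.2.2.inter_left (Subgroup.isClosed_of_isOpen _ hKsmU.1)
  have hleU : K ≤ KsmU := hle.trans inf_le_left
  have hle₀ : K ≤ K₀.1 := hle.trans inf_le_right
  -- the level `K' := levelOf K`, `= K` as a subgroup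
  set K' : C5.SmallLevel K₀ := (C F ι₁ V Φ).levelOf K
  have hcoe : ((K'.1 : C5.OpenCompactSubgroup _) : Subgroup (C F ι₁ V Φ).G) = K := (C F ι₁ V Φ).coe_levelOf hK hle₀
  have hK'U : (K'.1 : Subgroup (C F ι₁ V Φ).G) ≤ KsmU := by rw [hcoe]; exact hleU
  -- `hUnif` at the level `K'` regarded in `G(τ)(𝔸^∞)`
  obtain ⟨Cset, _, X, B, Γ, inj, hH, hΓ, ⟨hcol⟩⟩ := hunif K'.1 hK'U
  -- `d = [F⁺ : ℚ] > 1`: the Compact Case, `Sh(𝕍)_K` projective hence proper, `X_K = Sh(𝕍)_K`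
  have hd : 1 < Module.finrank ℚ (maximalRealSubfield F) := by
    have hmul := Module.finrank_mul_finrank ℚ (maximalRealSubfield F) F
    rw [Algebra.IsQuadraticExtension.finrank_eq_two (maximalRealSubfield F) F] at hmul
    omega
  have hproj : IsProjectiveOver ((C F ι₁ V Φ).S.Sh𝕍.obj K') := (C F ι₁ V Φ).cpt.projective_Sh_of (Or.inl hd) K'
  haveI : IsProper ((C F ι₁ V Φ).S.Sh𝕍.obj K').hom := hproj.isProper
  haveI : IsIso ((C F ι₁ V Φ).cpt.j.app K') := (C F ι₁ V Φ).cpt.isIso_j_of_isProper K' inferInstance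
  -- `X_K ⊗_{E,e ι₁} ℂ ≅ Sh(G(τ), h_{V(τ),e ι₁})_{fix τ K} ⊗ ℂ`
  have hcomp : ((e F ι₁).fieldRange.subtype).comp (e F ι₁).rangeRestrictField = e F ι₁ := RingHom.ext fun _ => rfl
  let eX : (baseChangeHom (e F ι₁)).obj ((C F ι₁ V Φ).X K') ≅
      (baseChangeHom (e F ι₁).fieldRange.subtype).obj
        (((P5 F ι₁ V Φ).Sh τ (e F ι₁)).obj (C5.OpenCompactSubgroup.transport ((P5 F ι₁ V Φ).fix τ) K'.1)) :=
    ((baseChangeHom (e F ι₁)).mapIso (asIso ((C F ι₁ V Φ).cpt.j.app K'))).symm ≪≫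
      (baseChangeHomObjIsoOfComp (e F ι₁).rangeRestrictField (e F ι₁).fieldRange.subtype (e F ι₁) hcomp ((C F ι₁ V Φ).S.Sh𝕍.obj K')).symm ≪≫
      (baseChangeHom (e F ι₁).fieldRange.subtype).mapIso (((C F ι₁ V Φ).S.iso τ (e F ι₁) hτ).app K')
  -- transport the coproduct decomposition to `X_K ⊗ ℂ`
  let inj' : ∀ c, X c ⟶ (baseChangeHom (e F ι₁)).obj ((C F ι₁ V Φ).X K') := fun c => inj c ≫ eX.inv
  have hcol' : Nonempty (IsColimit (Cofan.mk _ inj')) :=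
    ⟨hcol.ofIsoColimit (Cofan.ext eX.symm (fun c => rfl))⟩
  -- Albanese: product decomposition of `Alb_{X_K} ⊗ ℂ`
  obtain ⟨𝒥, π, hlim⟩ := hAlb F hG h6 Φ ι₁ hι V K' Cset inferInstance X inj' (fun c => (B c).isSmoothProjective) hcol'
  exact ⟨Cset, inferInstance, X, B, Γ, 𝒥, π, hH, hΓ, hlim⟩

end SplitAlong

/-! ## §3  The composite along `e ι₁` (package P2′ = the instance `e := fun _ ι₁ => (starRingEnd ℂ).comp ι₁`) -/

section CompositeAlong

/-- **`hReach` at the APPENDIX-C DATUM, pin `A_μ ⊗_{E,e ι₁} ℂ`, from {`hUnif`, `hAlb`}** — `pinReach_of_componentPinC_along ∘ hComp_of_unif_of_alb_along`.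
Binder family {hUnif, hAlb} (+ the consumer's carriers `P5`, `iso`, `C`, `R`, the embedding `e`, and `h₁`/`h₃` to state the tree surface).
HC_CM is NOT proved; `hUnif`, `hAlb` are not inhabited here.  CITATION SCOPE: as §1/§2.
[cite: Liu2021, Thm. 4.18 (1) (FJcycle.tex l. 2239), §4.2 l. 2060–2066, Def. 2.3, Def. 4.5 (2) l. 1944, Prop. C.5 l. 4627–4637, App. C l. 4656]
[cite: Deligne1979ShimuraVarieties, §2.1.2] -/
theorem pinReach_of_componentPinC_of_unif_of_alb_along
    (h₁ : BallQuotientUniformised) (h₃ : CMAbelianVarietyRealised)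
    (e : ∀ (F : CMField), (F →+* ℂ) → (F →+* ℂ))
    (P5 : ∀ (F : CMField) (ι₁ : F →+* ℂ) (_ : HermSpace3 F ι₁) (_ : CMType F), PropC5Data (maximalRealSubfield F) F)
    (iso : ∀ (F : CMField) (ι₁ : F →+* ℂ) (_ : HermSpace3 F ι₁) (_ : CMType F), ℕ → Prop)
    (C : ∀ (F : CMField) (ι₁ : F →+* ℂ) (V : HermSpace3 F ι₁) (Φ : CMType F), Sec42Data (P5 F ι₁ V Φ) (iso F ι₁ V Φ))
    (R : ∀ (F : CMField) (ι₁ : F →+* ℂ) (V : HermSpace3 F ι₁) (Φ : CMType F), Thm418Rest (C F ι₁ V Φ))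
    (hUnif : ∀ (F : CMField), IsGalois ℚ F → 6 ≤ Module.finrank ℚ F → ∀ (Φ : CMType F) (ι₁ : F →+* ℂ), ι₁ ∈ Φ.1 →
      ∀ (V : HermSpace3 F ι₁) (τ : maximalRealSubfield F →+* ℝ), C5.IsAbove τ (e F ι₁) →
        ∃ Ksm : Subgroup (P5 F ι₁ V Φ).G, IsOpenCompact Ksm ∧
          ∀ K : C5.OpenCompactSubgroup (P5 F ι₁ V Φ).G, K.1 ≤ Ksm →
            ∃ (Cset : Type) (_ : Fintype Cset) (X : Cset → SchemeOver ℂ) (B : ∀ c, UnitaryBallUniformisationDatum 2 (X c))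
              (Γ : Cset → Level V)
              (inj : ∀ c, X c ⟶ (baseChangeHom (e F ι₁).fieldRange.subtype).obj
                (((P5 F ι₁ V Φ).Sh τ (e F ι₁)).obj (C5.OpenCompactSubgroup.transport ((P5 F ι₁ V Φ).fix τ) K))),
              (∀ c, (B c).Hℂ = V.Hm.map ι₁) ∧
              (∀ c, (B c).Γ.map (Matrix.GeneralLinearGroup.map (B c).τ₁) =
                (Γ c).Γ.map (Matrix.GeneralLinearGroup.map ι₁)) ∧
              Nonempty (IsColimit (Cofan.mk _ inj)))
    (hAlb : ∀ (F : CMField), IsGalois ℚ F → 6 ≤ Module.finrank ℚ F → ∀ (Φ : CMType F) (ι₁ : F →+* ℂ), ι₁ ∈ Φ.1 →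
      ∀ (V : HermSpace3 F ι₁) (K' : C5.SmallLevel (C F ι₁ V Φ).S.K₀) (Cset : Type) (_ : Fintype Cset) (X : Cset → SchemeOver ℂ)
        (inj : ∀ c, X c ⟶ (baseChangeHom (e F ι₁)).obj ((C F ι₁ V Φ).X K')),
        (∀ c, IsSmoothProjective 2 (X c)) → Nonempty (IsColimit (Cofan.mk _ inj)) →
          ∃ (𝒥 : ∀ c, Jacobian (X c)) (π : ∀ c, (letI := (e F ι₁).toAlgebra; ((C F ι₁ V Φ).A K').baseChange ℂ) ⟶ (𝒥 c).J),
            Nonempty (IsLimit (Fan.mk (letI := (e F ι₁).toAlgebra; ((C F ι₁ V Φ).A K').baseChange ℂ) π))) :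
    ∀ (F : CMField), IsGalois ℚ F → 6 ≤ Module.finrank ℚ F → ∀ (Φ : CMType F) (ι₁ : F →+* ℂ), ι₁ ∈ Φ.1 →
      ∀ V : HermSpace3 F ι₁, ∃ Ksm : Subgroup (toThm418Data (C F ι₁ V Φ) (R F ι₁ V Φ)).G, IsOpenCompact Ksm ∧
        ∀ (K : Subgroup (toThm418Data (C F ι₁ V Φ) (R F ι₁ V Φ)).G) (Dμ : (toThm418Data (C F ι₁ V Φ) (R F ι₁ V Φ)).Obj)
          (φ : (toThm418Data (C F ι₁ V Φ) (R F ι₁ V Φ)).HomK K Dμ),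
          IsOpenCompact K → K ≤ Ksm → φ ≠ 0 →
            ∃ (Γ : Level V) (𝒥 : Jacobian (Var.scheme (ballQuotientUniformisedDatum_of h₁) h₃ (.pms (pmsCode F ι₁ V Γ))))
              (w : 𝒥.J ⟶ (letI := (e F ι₁).toAlgebra; ((R F ι₁ V Φ).Aμ Dμ).baseChange ℂ)), w ≠ 0 :=
  pinReach_of_componentPinC_along h₁ h₃ e P5 iso C R (hComp_of_unif_of_alb_along e P5 iso C hUnif hAlb)

end CompositeAlong

/-! ## §5  `hUnif` from a COFAN BY TREE SURFACES (the consumer-side simplification for TEAM hComp) -/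

section TreeCofan

/-- **`hUnif` along `e ι₁` from a cofan by TREE surfaces.**  The binder `hUnif` asks for pieces `X c` carrying ball data
`B c : UnitaryBallUniformisationDatum 2 (X c)` matching the tree's `V`-tower; downstream (tree `pinReach_of_componentPin`) those data
are used ONLY to identify `X c` with the tree surface `P_{Γ_c}(V)` by model uniqueness (`UnitaryBallModelUnique.exists_iso_of_eq`).  So it
suffices — and this is the shape TEAM hComp should target — that LIU'S `Sh(G(τ), h_{V(τ),e ι₁})_{fix τ K} ⊗_{(e ι₁)(E)} ℂ` be a finite
COPRODUCT OF TREE SURFACES `P_{Γ_c}(V) := Var.scheme (ballQuotientUniformisedDatum_of h₁) h₃ (.pms (pmsCode F ι₁ V (Γ c)))` for SOME levels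
`Γ c : Level V` (binder `hTree`; at `e ι₁ = ῑ₁` with NATURAL levels `Γ_g = U(V)(F⁺) ∩ gKg⁻¹` this is [Deligne 1979, §2.1.2] «`Sh_K(ℂ)` is the
disjoint sum, indexed by `G(ℚ)\G(𝔸^f)/K`, of the `Γ_g\X⁺`» read on the Baily–Borel algebraisations, which ARE the tree surfaces
(`BallQuotientUniformised` h₁ + `UnitaryBallModelUnique`), together with the DEFINITION of a model over the reflex field [Deligne 1979,
2.2.1–2.2.5]: `M_K ⊗_E ℂ ≅ Sh_K`).  The pieces then carry the tree's own ball data `Var.ballDatum … (pmsCode F ι₁ V (Γ c))` whose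
Gram-matrix and group clauses are the tree lemmas `Model.ballDatum_Hℂ` (`B01/HeckePair.lean`) and `Model.ballDatum_pmsCode_map_Γ`
(`AlbaneseSideModelMatch.lean`), anisotropy from `6 ≤ [F:ℚ]` (`isAnisotropic_pmsCode_of_two_lt`).  Bookkeeping, ours; `hTree` is not
inhabited here.  HC_CM is NOT proved. [cite: Deligne1979ShimuraVarieties, §2.1.2 and 2.2.1–2.2.5] -/
theorem hUnif_of_treeCofan_along
    (h₁ : BallQuotientUniformised) (h₃ : CMAbelianVarietyRealised)
    (e : ∀ (F : CMField), (F →+* ℂ) → (F →+* ℂ))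
    (P5 : ∀ (F : CMField) (ι₁ : F →+* ℂ) (_ : HermSpace3 F ι₁) (_ : CMType F), PropC5Data (maximalRealSubfield F) F)
    (hTree : ∀ (F : CMField), IsGalois ℚ F → 6 ≤ Module.finrank ℚ F → ∀ (Φ : CMType F) (ι₁ : F →+* ℂ), ι₁ ∈ Φ.1 →
      ∀ (V : HermSpace3 F ι₁) (τ : maximalRealSubfield F →+* ℝ), C5.IsAbove τ (e F ι₁) →
        ∃ Ksm : Subgroup (P5 F ι₁ V Φ).G, IsOpenCompact Ksm ∧
          ∀ K : C5.OpenCompactSubgroup (P5 F ι₁ V Φ).G, K.1 ≤ Ksm →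
            ∃ (Cset : Type) (_ : Fintype Cset) (Γ : Cset → Level V)
              (inj : ∀ c, Var.scheme (ballQuotientUniformisedDatum_of h₁) h₃ (.pms (pmsCode F ι₁ V (Γ c))) ⟶
                (baseChangeHom (e F ι₁).fieldRange.subtype).obj
                  (((P5 F ι₁ V Φ).Sh τ (e F ι₁)).obj (C5.OpenCompactSubgroup.transport ((P5 F ι₁ V Φ).fix τ) K))),
              Nonempty (IsColimit (Cofan.mk _ inj))) :
    ∀ (F : CMField), IsGalois ℚ F → 6 ≤ Module.finrank ℚ F → ∀ (Φ : CMType F) (ι₁ : F →+* ℂ), ι₁ ∈ Φ.1 →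
      ∀ (V : HermSpace3 F ι₁) (τ : maximalRealSubfield F →+* ℝ), C5.IsAbove τ (e F ι₁) →
        ∃ Ksm : Subgroup (P5 F ι₁ V Φ).G, IsOpenCompact Ksm ∧
          ∀ K : C5.OpenCompactSubgroup (P5 F ι₁ V Φ).G, K.1 ≤ Ksm →
            ∃ (Cset : Type) (_ : Fintype Cset) (X : Cset → SchemeOver ℂ) (B : ∀ c, UnitaryBallUniformisationDatum 2 (X c))
              (Γ : Cset → Level V)
              (inj : ∀ c, X c ⟶ (baseChangeHom (e F ι₁).fieldRange.subtype).obj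
                (((P5 F ι₁ V Φ).Sh τ (e F ι₁)).obj (C5.OpenCompactSubgroup.transport ((P5 F ι₁ V Φ).fix τ) K))),
              (∀ c, (B c).Hℂ = V.Hm.map ι₁) ∧
              (∀ c, (B c).Γ.map (Matrix.GeneralLinearGroup.map (B c).τ₁) =
                (Γ c).Γ.map (Matrix.GeneralLinearGroup.map ι₁)) ∧
              Nonempty (IsColimit (Cofan.mk _ inj)) := by
  intro F hG h6 Φ ι₁ hι V τ hτ
  obtain ⟨Ksm, hKsm, h⟩ := hTree F hG h6 Φ ι₁ hι V τ hτ
  refine ⟨Ksm, hKsm, fun K hK => ?_⟩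
  obtain ⟨Cset, _, Γ, inj, hcol⟩ := h K hK
  have hF : 2 < Module.finrank ℚ F := by omega
  exact ⟨Cset, inferInstance, fun c => Var.scheme (ballQuotientUniformisedDatum_of h₁) h₃ (.pms (pmsCode F ι₁ V (Γ c))),
    fun c => Var.ballDatum (ballQuotientUniformisedDatum_of h₁) h₃ (pmsCode F ι₁ V (Γ c)) (isAnisotropic_pmsCode_of_two_lt hF (Γ c)),
    Γ, inj, fun c => ballDatum_Hℂ _ _ (Γ c) _, fun c => ballDatum_pmsCode_map_Γ _ _ (Γ c) _, hcol⟩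

/-- **`hReach` at the APPENDIX-C DATUM, pin `A_μ ⊗_{E,e ι₁} ℂ`, from {`hTree`, `hAlb`}** — the END-TO-END pin-1 composite for TEAM hComp:
`hTree` (Liu's isometry-type Shimura variety base-changed to `ℂ` is a finite coproduct of TREE surfaces `P_{Γ_c}(V)`; [Deligne 1979 §2.1.2
+ 2.2.1–2.2.5] on Liu's carrier `PropC5Data.Sh τ (e ι₁)`, App. C Rem. C.2 / l. 4599) and `hAlb` ([Liu2021 §2.1 Prop.]: `Alb` vs base change
along `e ι₁` and components) give own-htheta's `hReach` VERBATIM (`hUnif_of_treeCofan_along`, `hComp_of_unif_of_alb_along`,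
`pinReach_of_componentPinC_along`).  Binder family {hTree, hAlb} (+ carriers `P5 iso C R`, the embedding `e`, `h₁`/`h₃`).  HC_CM is NOT
proved; `hTree`, `hAlb` are not inhabited here.  CITATION SCOPE: as §1/§2/§5.
[cite: Liu2021, Thm. 4.18 (1) (FJcycle.tex l. 2239), §4.2 l. 2060–2066, Def. 2.3, Def. 4.5 (2) l. 1944, Prop. C.5 l. 4627–4637, App. C l. 4656]
[cite: Deligne1979ShimuraVarieties, §2.1.2 and 2.2.1–2.2.5] -/
theorem pinReach_of_treeCofan_of_alb_along
    (h₁ : BallQuotientUniformised) (h₃ : CMAbelianVarietyRealised)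
    (e : ∀ (F : CMField), (F →+* ℂ) → (F →+* ℂ))
    (P5 : ∀ (F : CMField) (ι₁ : F →+* ℂ) (_ : HermSpace3 F ι₁) (_ : CMType F), PropC5Data (maximalRealSubfield F) F)
    (iso : ∀ (F : CMField) (ι₁ : F →+* ℂ) (_ : HermSpace3 F ι₁) (_ : CMType F), ℕ → Prop)
    (C : ∀ (F : CMField) (ι₁ : F →+* ℂ) (V : HermSpace3 F ι₁) (Φ : CMType F), Sec42Data (P5 F ι₁ V Φ) (iso F ι₁ V Φ))
    (R : ∀ (F : CMField) (ι₁ : F →+* ℂ) (V : HermSpace3 F ι₁) (Φ : CMType F), Thm418Rest (C F ι₁ V Φ))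
    (hTree : ∀ (F : CMField), IsGalois ℚ F → 6 ≤ Module.finrank ℚ F → ∀ (Φ : CMType F) (ι₁ : F →+* ℂ), ι₁ ∈ Φ.1 →
      ∀ (V : HermSpace3 F ι₁) (τ : maximalRealSubfield F →+* ℝ), C5.IsAbove τ (e F ι₁) →
        ∃ Ksm : Subgroup (P5 F ι₁ V Φ).G, IsOpenCompact Ksm ∧
          ∀ K : C5.OpenCompactSubgroup (P5 F ι₁ V Φ).G, K.1 ≤ Ksm →
            ∃ (Cset : Type) (_ : Fintype Cset) (Γ : Cset → Level V)
              (inj : ∀ c, Var.scheme (ballQuotientUniformisedDatum_of h₁) h₃ (.pms (pmsCode F ι₁ V (Γ c))) ⟶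
                (baseChangeHom (e F ι₁).fieldRange.subtype).obj
                  (((P5 F ι₁ V Φ).Sh τ (e F ι₁)).obj (C5.OpenCompactSubgroup.transport ((P5 F ι₁ V Φ).fix τ) K))),
              Nonempty (IsColimit (Cofan.mk _ inj)))
    (hAlb : ∀ (F : CMField), IsGalois ℚ F → 6 ≤ Module.finrank ℚ F → ∀ (Φ : CMType F) (ι₁ : F →+* ℂ), ι₁ ∈ Φ.1 →
      ∀ (V : HermSpace3 F ι₁) (K' : C5.SmallLevel (C F ι₁ V Φ).S.K₀) (Cset : Type) (_ : Fintype Cset) (X : Cset → SchemeOver ℂ)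
        (inj : ∀ c, X c ⟶ (baseChangeHom (e F ι₁)).obj ((C F ι₁ V Φ).X K')),
        (∀ c, IsSmoothProjective 2 (X c)) → Nonempty (IsColimit (Cofan.mk _ inj)) →
          ∃ (𝒥 : ∀ c, Jacobian (X c)) (π : ∀ c, (letI := (e F ι₁).toAlgebra; ((C F ι₁ V Φ).A K').baseChange ℂ) ⟶ (𝒥 c).J),
            Nonempty (IsLimit (Fan.mk (letI := (e F ι₁).toAlgebra; ((C F ι₁ V Φ).A K').baseChange ℂ) π))) :
    ∀ (F : CMField), IsGalois ℚ F → 6 ≤ Module.finrank ℚ F → ∀ (Φ : CMType F) (ι₁ : F →+* ℂ), ι₁ ∈ Φ.1 →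
      ∀ V : HermSpace3 F ι₁, ∃ Ksm : Subgroup (toThm418Data (C F ι₁ V Φ) (R F ι₁ V Φ)).G, IsOpenCompact Ksm ∧
        ∀ (K : Subgroup (toThm418Data (C F ι₁ V Φ) (R F ι₁ V Φ)).G) (Dμ : (toThm418Data (C F ι₁ V Φ) (R F ι₁ V Φ)).Obj)
          (φ : (toThm418Data (C F ι₁ V Φ) (R F ι₁ V Φ)).HomK K Dμ),
          IsOpenCompact K → K ≤ Ksm → φ ≠ 0 →
            ∃ (Γ : Level V) (𝒥 : Jacobian (Var.scheme (ballQuotientUniformisedDatum_of h₁) h₃ (.pms (pmsCode F ι₁ V Γ))))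
              (w : 𝒥.J ⟶ (letI := (e F ι₁).toAlgebra; ((R F ι₁ V Φ).Aμ Dμ).baseChange ℂ)), w ≠ 0 :=
  pinReach_of_componentPinC_of_unif_of_alb_along h₁ h₃ e P5 iso C R (hUnif_of_treeCofan_along h₁ h₃ e P5 hTree) hAlb

end TreeCofan

end Summit.HodgeConjecture.CorCM.Model

end
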